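import Mathlib

/-!
# The joint-slack reduction for unions of blocks (blind cell PercRepro2, night-4 g17, 2026-08-27;
proofs/NIGHT4-G17.md §4)

The rigid counting inequality of (HLC) on a block `A` of configurations reads, for a conditioning `P`
and an up-set-derived pair of predicates `R` («the red edge set is accepted») and `B` («the blue edge
set is accepted»), `#(A ∩ P ∩ R) ≤ #(A ∩ P ∩ B)`.  The surviving candidate for the mixed-arm case of
the single junction (NIGHT4-G17.md §3) is a UNION of blocks each satisfying the inequality — the core
cube and the complete coarse orbits of its dropped one-sided points — that overlap.  This file records
the arithmetic of such a union once and for all, for arbitrary finsets and predicates: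

* `card_union_le_of_overlap_le` — if both blocks satisfy the inequality and on the overlap the blue
  count is at most the red count (the overlap «pays»), so does the union;
* `card_union_le_of_joint_slack` — more generally the union satisfies the inequality as soon as the
  slacks of the two blocks together cover the deficit of the overlap:
  `b(A ∩ B) + r(A) + r(B) ≤ r(A ∩ B) + b(A) + b(B)` (the JOINT-SLACK statement of G12 §5′(g));
* `joint_slack_of_card_union_le` — and conversely (the statement is exactly what is needed).

Nothing here is about percolation; the point is to pin the open item of the mixed-arm case to one
inequality on one overlap.
-/

namespace Summit.Ventures.PercRepro2

namespace JointSlack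

variable {α : Type*} [DecidableEq α] (A B : Finset α) (R Bl : α → Prop) [DecidablePred R]
  [DecidablePred Bl]

/-- Inclusion–exclusion for a filtered count: `#(A ∪ B) + #(A ∩ B) = #A + #B` on the filter. -/
lemma card_filter_union_add_card_filter_inter :
    ((A ∪ B).filter R).card + ((A ∩ B).filter R).card = (A.filter R).card + (B.filter R).card := by
  rw [Finset.filter_union, Finset.filter_inter_distrib, Finset.card_union_add_card_inter]

/-- **The joint-slack reduction**: if the overlap's deficit `b(A ∩ B) − r(A ∩ B)` is covered by the
slacks `(b(A) − r(A)) + (b(B) − r(B))` of the two blocks, the union satisfies the inequality. -/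
theorem card_union_le_of_joint_slack
    (hslack : ((A ∩ B).filter Bl).card + (A.filter R).card + (B.filter R).card ≤
      ((A ∩ B).filter R).card + (A.filter Bl).card + (B.filter Bl).card) :
    ((A ∪ B).filter R).card ≤ ((A ∪ B).filter Bl).card := by
  have h1 := card_filter_union_add_card_filter_inter A B R
  have h2 := card_filter_union_add_card_filter_inter A B Bl
  omega

/-- **The overlap pays**: if both blocks satisfy the inequality and on the overlap the blue count is at
most the red count, the union satisfies the inequality. -/
theorem card_union_le_of_overlap_le (hA : (A.filter R).card ≤ (A.filter Bl).card)
    (hB : (B.filter R).card ≤ (B.filter Bl).card)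
    (hAB : ((A ∩ B).filter Bl).card ≤ ((A ∩ B).filter R).card) :
    ((A ∪ B).filter R).card ≤ ((A ∪ B).filter Bl).card :=
  card_union_le_of_joint_slack A B R Bl (by omega)

/-- Conversely, the inequality on the union IS the joint-slack statement. -/
theorem joint_slack_of_card_union_le
    (h : ((A ∪ B).filter R).card ≤ ((A ∪ B).filter Bl).card) :
    ((A ∩ B).filter Bl).card + (A.filter R).card + (B.filter R).card ≤
      ((A ∩ B).filter R).card + (A.filter Bl).card + (B.filter Bl).card := by
  have h1 := card_filter_union_add_card_filter_inter A B R
  have h2 := card_filter_union_add_card_filter_inter A B Bl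
  omega

/-- Disjoint blocks: the union satisfies the inequality when both blocks do (the overlap is empty). -/
theorem card_union_le_of_disjoint (hdisj : Disjoint A B)
    (hA : (A.filter R).card ≤ (A.filter Bl).card)
    (hB : (B.filter R).card ≤ (B.filter Bl).card) :
    ((A ∪ B).filter R).card ≤ ((A ∪ B).filter Bl).card := by
  refine card_union_le_of_overlap_le A B R Bl hA hB ?_
  rw [Finset.disjoint_iff_inter_eq_empty.1 hdisj]
  simp

end JointSlack

end Summit.Ventures.PercRepro2
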